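import Summits.QuantumFields.YangMills.Theorems.BalabanUVNodesN15CurvedGluingSmoothCutDressedGluedGaugedUN
import Summits.QuantumFields.YangMills.Theorems.BalabanUVNodesN15PerCubeGreenJetCubes
import HarnessLib

/-!
# N15 = NE2, road (c) — PROGRAMME (PC), towards (PC-A′) «the COVARIANT GRADIENT entries of [B9] (3.42) in per-cube gauges», IV: dag-n15-w3 52's `U(N)` CAPSTONE WITH A LEFT FACTOR —
# the glued propagator of `Δ_{R_U} + P` from dressed smooth-cut cubes in their own unitary small-field gauges (52's discharges verbatim), composed on the left with an operator of
# DISPLAYED gauge covariance (dag-n15-c g26, n15-c∕272)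

Cell `pub-ymgap`, seat `pub-ymgap-dag-n15-c` (generation g26; R134 (a), s1; HUMAN RULING D-0062).  `bears_on: R4∕N15 · K3⁸ SpineGivenEndpointR13SepCoPHV (stmt-QuantumFields-27366)`.
Filed `--kind proof --supports stmt-QuantumFields-27366 --as helper` — COUNT-NEUTRAL.  One theorem; 0 `def`, 0 `sorry`.  Imports BY NAME dag-n15-w3 52 `…CurvedGluingSmoothCutDressedGluedGaugedUN`
(its discharges repeated VERBATIM: dag-n15-w2 `uN_siteGauge_orthogonal`, `uN_localOp_species_form`, files 49–51 `localOp_eq_cut_add_farDefect`, `hasMaj_cutPert_structural_of_local`,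
`hasMaj_mulOp_farDefect_smoothCutDressed`, `hasMaj_commOp_farDefect_structural`) and n15-c∕269 `…PerCubeGreenJetCubes` (`hasMaj_comp_glueInv_smoothCutDressed_localGauges`).  Nothing in
the tree is modified, no landed name re-declared.  GENERATED from the tree text of 52 by the seat's `buildKU.py` (statement = 52's hypotheses + 269's jet block; proof = 52's body with
269 in place of 47).

WHY.  n15-c∕262 (`uN_scGlued_spec`) — the knit behind the scalar covariant Green's function `G′(U)` of n15-c∕265∕266 — is the SITE INSTANTIATION of 52, generated from 52's binder list.
The covariant gradient rows `D_UG′(U)` (entries 2–3 of (3.42), (PC-A′)) need the same instantiation of «52 with `D∘` in front»: THIS FILE is that theorem, with the binder list = 52's +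
269's jet block, so n15-c∕262's generator applies with the jet block appended (the jet data on sites: `D = covD` by n15-c∕270, `P^sp_k` = the transport species `n(R^{w_k} − 1)` under the
cut with its (3.35) letter, `P^far_k` the rest).

HONEST FRAMING ∕ LIMITS.  Composition of LANDED theorems over DISPLAYED rows on model carriers; the gauges `u_k`, the local (3.35) letters, `P`'s conjugation law, `N_V`'s letters and
the jet data are HYPOTHESES; nothing of [B5]∕[B6]∕[B9] asserted ((2.91)–(2.93) p.239, (2.133)–(2.136) p.247, (3.34)–(3.35) p.396, (3.42) p.397, (3.50)–(3.53) p.400, (3.62)–(3.65)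
pp.402–403 = SHAPES ∕ MECHANISM).  NE2⁺ NOT PRINTED, NOT proved; N15 NOT discharged (of record: DISCHARGED AS CONSUMED, p687738); K3⁸ OPEN; counts of record UNMOVED (typed 28∕28 ·
discharged 8∕27); one finite 𝕋⁴ at fixed ε — NOT infinite volume, NOT OS on ℝ⁴, NOT a mass gap, NOT Clay.  Restate-immune (no Theses import).
-/

set_option autoImplicit false

noncomputable section
open scoped BigOperators Matrix Matrix.Norms.Frobenius
open Finset

namespace Summit.QuantumFields.YangMills.BalabanUVNodes.N15.CurvedSpecies

open Literature.MathematicalPhysics.QuantumFieldTheory.Balaban1983to89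
open Literature.MathematicalPhysics.QuantumFieldTheory.Balaban1983to89.B11SectG (BlockNorm HasMaj RowSum hasMaj_zero)
open Literature.MathematicalPhysics.QuantumFieldTheory.Balaban1983to89.B6RandomWalk (Triangle254)
open Literature.MathematicalPhysics.QuantumFieldTheory.Balaban1983to89.B6Prop26Gluing (mulOp mulOp_apply ind ind_nonneg ind_le_one)
open Summit.QuantumFields.YangMills.BalabanUVNodes.N15.MatrixSpecies (mmulOp liftBlk liftEquiv liftEquiv_apply liftEquiv_symm_apply coordMat)
open Summit.QuantumFields.YangMills.BalabanUVNodes.N15.BackgroundLayer (fgrad bgrad fgradAdj stack projO blkPair bgPropV covLapM tCoefA tCoefC unstackM projO_none_comp_stack)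
open Summit.QuantumFields.YangMills.BalabanUVNodes.N15.Gluing (commOp lapOp parametrix remainder glueInv)
open Literature.Barriers.QuantumFields (traceForm)

variable {X ι J K : Type} [Fintype X] [DecidableEq X] [Fintype ι] [DecidableEq ι] [Fintype J] [DecidableEq J] [Fintype K] {g : B6.Geometry} (blk : X → g.Site) (τ : J → X ≃ X)
  {σ cr : ℝ} {N : K → (X × ι → ℝ) →ₗ[ℝ] (X × ι → ℝ)} {NL : (X × ι → ℝ) →ₗ[ℝ] (X × ι → ℝ)}
  {χX χtX ψX hX : K → X → ℝ} {Sk : K → Set g.Site} {hb : K → g.Site → ℝ} {β β₁ ct δ : ℝ}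

/-- ★★★ **A LEFT FACTOR THROUGH THE GLUED PROPAGATOR OF BAŁABAN's COVARIANT OPERATOR `Δ_{R_U} + P` FROM DRESSED SMOOTH-CUT CUBES IN THEIR OWN UNITARY SMALL-FIELD GAUGES**: dag-n15-w3 52
`uN_hasMaj_glueInv_smoothCutDressed_localGauges` (unitary bond variables `U`, trace-form coordinates `e`, per-cube unitary site gauges `u_k`, the species of the transformed bond variables
cut to the cube, the summand `P` with its conjugation law, `N_V k`; 52's discharges 49–51 VERBATIM) composed on the left with an operator `D` whose gauge covariance
`D∘M_{W_kᵀ} = M_{v_kᵀ}∘(∇_j + P^sp_k + P^far_k)` (`W_k = coordMat e Ad_{u_k}`) and Leibniz rule are DISPLAYED (n15-c∕269's jet data): `D∘𝒢 ≤ N_ov(c_s|ι|²β̄′(1 + r_Pc_r) +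
c_d|ι|²β̄′)(1 − …)⁻¹c_r·e^{−(ρ₃−σ)d}` with 52's denominator.  The binder list is 52's + the jet block, so the site instantiation is n15-c∕262's generator with the jet block appended; for
`D = D_{U,μ}` the covariance is n15-c∕270 (`covD_comp_mmulOp_transpose`, `v_k = W_k`; `covD_eq_fgrad_add` split under ∕ beyond the cut).
[cite: Balaban1985BackgroundPropagators, (3.34)–(3.35) p.396, (3.42) p.397 (gradient entries: shape), (3.52) p.400, (3.62)–(3.65) pp.402–403, (3.87) p.409 (mechanism); Balaban1984PropagatorsII, (2.91)–(2.93) p.239, (2.133)–(2.136) p.247] -/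
theorem uN_hasMaj_comp_glueInv_smoothCutDressed_localGauges {m : Type} [Fintype m] [DecidableEq m] (e : Matrix m m ℂ ≃L[ℝ] (ι → ℝ)) {u : K → X → Matrix m m ℂ} {U : J → X → Matrix m m ℂ}
    {P : (X × ι → ℝ) →ₗ[ℝ] (X × ι → ℝ)} {NV : K → (X × ι → ℝ) →ₗ[ℝ] (X × ι → ℝ)} (η : ℝ) (htri : Triangle254 g) (hd : ∀ a b : g.Site, 0 ≤ g.dist a b) (hd0 : ∀ y : g.Site, g.dist y y = 0) (hsymm : ∀ y y', g.dist y y' = g.dist y' y)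
    (hrow : RowSum g σ cr) (hσ : 0 ≤ σ) {ρ₁ ρ₂ ρ₃ ρN ρT δV ε R ε₀ c₁ c₂ θW cN ℓ ω d₁ Nov : ℝ} (hβ : 0 ≤ β) (hβ₁ : 0 ≤ β₁) (hct : 0 ≤ ct) (hR : 0 ≤ R) (hε₀ : 0 ≤ ε₀) (hcr : 0 ≤ cr) (hNov : 0 ≤ Nov) (hσρ : σ ≤ ρ₁) (hρ₁V : ρ₁ ≤ δV)
    (hρ₁G : ρ₁ + σ ≤ δ) (hρ₂ : 0 ≤ ρ₂) (hρ₂₁ : ρ₂ + σ ≤ ρ₁) (hρ₂T : ρ₂ + σ ≤ ρT) (hρ₃ : 0 ≤ ρ₃) (hρ₃₂ : ρ₃ ≤ ρ₂) (hρ₃V : ρ₃ + σ ≤ δV - ε) (hρ₃N : ρ₃ + σ ≤ ρN) (hσρ₃ : 2 * σ ≤ ρ₃)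
    (hε : 0 < ε) (hc₁ : 0 ≤ c₁) (hc₂ : 0 ≤ c₂) (hθW : 0 ≤ θW) (hcN : 0 ≤ cN) (hℓ : 0 ≤ ℓ) (hω : 0 ≤ ω) (hd₁ : 0 ≤ d₁)
    -- per cube: supports, the bump and its insertions (both ways), the input cut-off
    (hSχ : ∀ k x, χX k x ≠ 0 → blk x ∈ Sk k) (hSψ : ∀ k x, ψX k x ≠ 0 → blk x ∈ Sk k) (hχt : ∀ k x, |χtX k x| ≤ 1)
    (hdχt : ∀ k μ p, |fgrad η⁻¹ (liftEquiv (τ μ) ι) (fun p : X × ι => χtX k p.1) p| ≤ ct) (hdχtb : ∀ k μ p, |bgrad η⁻¹ (liftEquiv (τ μ) ι) (fun p : X × ι => χtX k p.1) p| ≤ ct)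
    (hsub : ∀ k, mulOp (fun p : X × ι => χtX k p.1) ∘ₗ mulOp (fun p : X × ι => χX k p.1) = mulOp (fun p : X × ι => χtX k p.1))
    (hχ : ∀ k, mulOp (fun p : X × ι => χX k p.1) ∘ₗ mulOp (fun p : X × ι => χtX k p.1) = mulOp (fun p : X × ι => χtX k p.1))
    (hs : ∀ k μ, mulOp ((fun p : X × ι => χtX k p.1) ∘ (liftEquiv (τ μ) ι)) ∘ₗ mulOp (fun p : X × ι => χX k p.1) = mulOp ((fun p : X × ι => χtX k p.1) ∘ (liftEquiv (τ μ) ι)))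
    (hsb : ∀ k μ, mulOp ((fun p : X × ι => χtX k p.1) ∘ (liftEquiv (τ μ) ι).symm) ∘ₗ mulOp (fun p : X × ι => χX k p.1) = mulOp ((fun p : X × ι => χtX k p.1) ∘ (liftEquiv (τ μ) ι).symm))
    (hdd : ∀ k μ, mulOp (fgrad η⁻¹ (liftEquiv (τ μ) ι) (fun p : X × ι => χtX k p.1)) ∘ₗ mulOp (fun p : X × ι => χX k p.1) = mulOp (fgrad η⁻¹ (liftEquiv (τ μ) ι) (fun p : X × ι => χtX k p.1)))
    (hddb : ∀ k μ, mulOp (bgrad η⁻¹ (liftEquiv (τ μ) ι) (fun p : X × ι => χtX k p.1)) ∘ₗ mulOp (fun p : X × ι => χX k p.1) = mulOp (bgrad η⁻¹ (liftEquiv (τ μ) ι) (fun p : X × ι => χtX k p.1)))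
    (hs' : ∀ k μ, mulOp (fun p : X × ι => χX k p.1) ∘ₗ mulOp ((fun p : X × ι => χtX k p.1) ∘ (liftEquiv (τ μ) ι)) = mulOp ((fun p : X × ι => χtX k p.1) ∘ (liftEquiv (τ μ) ι)))
    (hsb' : ∀ k μ, mulOp (fun p : X × ι => χX k p.1) ∘ₗ mulOp ((fun p : X × ι => χtX k p.1) ∘ (liftEquiv (τ μ) ι).symm) = mulOp ((fun p : X × ι => χtX k p.1) ∘ (liftEquiv (τ μ) ι).symm))
    (hdd' : ∀ k μ, mulOp (fun p : X × ι => χX k p.1) ∘ₗ mulOp (fgrad η⁻¹ (liftEquiv (τ μ) ι) (fun p : X × ι => χtX k p.1)) = mulOp (fgrad η⁻¹ (liftEquiv (τ μ) ι) (fun p : X × ι => χtX k p.1)))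
    (hddb' : ∀ k μ, mulOp (fun p : X × ι => χX k p.1) ∘ₗ mulOp (bgrad η⁻¹ (liftEquiv (τ μ) ι) (fun p : X × ι => χtX k p.1)) = mulOp (bgrad η⁻¹ (liftEquiv (τ μ) ι) (fun p : X × ι => χtX k p.1)))
    (hNψ : ∀ k, N k ∘ₗ mulOp (fun p : X × ι => ψX k p.1) = N k)
    -- per cube: FILE 63's cut rows
    (hcut : ∀ k, HasMaj (BlockNorm.ofBlocks g (liftBlk blk ι)) (BlockNorm.ofBlocks g (liftBlk blk ι)) (mulOp (fun p : X × ι => χX k p.1) ∘ₗ N k) (fun y y' => ind (Sk k) y * ind (Sk k) y' * (β * Real.exp (-(δ * g.dist y y')))))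
    (hcutF : ∀ k μ, HasMaj (BlockNorm.ofBlocks g (liftBlk blk ι)) (BlockNorm.ofBlocks g (liftBlk blk ι)) (mulOp (fun p : X × ι => χX k p.1) ∘ₗ (fgrad η⁻¹ (liftEquiv (τ μ) ι) ∘ₗ N k)) (fun y y' => ind (Sk k) y * ind (Sk k) y' * (β₁ * Real.exp (-(δ * g.dist y y')))))
    (hcutB : ∀ k μ, HasMaj (BlockNorm.ofBlocks g (liftBlk blk ι)) (BlockNorm.ofBlocks g (liftBlk blk ι)) (mulOp (fun p : X × ι => χX k p.1) ∘ₗ (bgrad η⁻¹ (liftEquiv (τ μ) ι) ∘ₗ N k)) (fun y y' => ind (Sk k) y * ind (Sk k) y' * (β₁ * Real.exp (-(δ * g.dist y y')))))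
    -- per cube: the partition (`|h| ≤ 1`, `Σh² = 1`, supported in the cut: `M_hM_χ = M_h`, letters `c₁, c₂`, block reading `hb` with `ℓ, ω`), one-step block distance `d₁`, overlap `N_ov`
    (hhabs : ∀ k x, |hX k x| ≤ 1) (hhcut : ∀ k, mulOp (fun p : X × ι => hX k p.1) ∘ₗ mulOp (fun p : X × ι => χX k p.1) = mulOp (fun p : X × ι => hX k p.1))
    (hh1 : ∀ k μ p, |fgrad η⁻¹ (liftEquiv (τ μ) ι) (fun p : X × ι => hX k p.1) p| ≤ c₁) (hh1b : ∀ k μ p, |bgrad η⁻¹ (liftEquiv (τ μ) ι) (fun p : X × ι => hX k p.1) p| ≤ c₁) (hh2 : ∀ k μ p, |fgradAdj η⁻¹ (liftEquiv (τ μ) ι) (fgrad η⁻¹ (liftEquiv (τ μ) ι) (fun p : X × ι => hX k p.1)) p| ≤ c₂)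
    (hLip : ∀ k y y', |hb k y - hb k y'| ≤ ℓ * g.dist y y') (hrh : ∀ k (p : X × ι), |hX k p.1 - hb k (liftBlk blk ι p)| ≤ ω) (hstep : ∀ μ x, g.dist (blk (τ μ x)) (blk x) ≤ d₁)
    (hN : ∀ a, ∑ k, ind (Sk k) a ≤ Nov)
    -- per cube: the tail row (dag-n15-a's images geometry ∕ FILE 68's far sandwich)
    (hT : ∀ k, HasMaj (BlockNorm.ofBlocks g (liftBlk blk ι)) (BlockNorm.ofBlocks g (liftBlk blk ι)) ((-(mulOp (fun p : X × ι => hX k p.1) ∘ₗ NL ∘ₗ mulOp (1 - fun p : X × ι => χtX k p.1))) ∘ₗ N k) (fun y y' => ind (Sk k) y * ind (Sk k) y' * (ε₀ * Real.exp (-(ρT * g.dist y y')))))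
    (hq : (β + (β₁ + ct * β)) * (R * cr) * cr < 1)
    (hKN : ∀ k, HasMaj (BlockNorm.ofBlocks g (liftBlk blk ι)) (BlockNorm.ofBlocks g (liftBlk blk ι)) (commOp NL (fun p : X × ι => hX k p.1)) (fun y y' => cN * Real.exp (-(ρN * g.dist y y'))))
    -- THE GAUGE GROUP OF RECORD: trace-form coordinates `e` of `𝔤 = 𝔲(m)`, unitary per-cube site gauges `u_k`, unitary bond variables `U`, Bałaban's nonlocal summand `P` read in cube `k`'s
    -- gauge as the flat `N_L` minus a per-cube nonlocal perturbation `N_V k`; the species of the transformed bond variables SMALL WHERE `χ_k ≠ 0` ((3.35) on the cube); letters of `N_V k`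
    (he : ∀ A B : Matrix m m ℂ, traceForm A B = e A ⬝ᵥ e B) (hu : ∀ k x, (u k x)ᴴ * u k x = 1) {rV RN θF ρF : ℝ} (hrV : 0 ≤ rV) (hRN : 0 ≤ RN) (hθF : 0 ≤ θF) (hρF : ρ₃ + σ ≤ ρF)
    (hRle : rV * (1 + Fintype.card (J ⊕ J)) + RN ≤ R)
    (hP : ∀ k, mmulOp (fun x => coordMat e (ContinuousLinearMap.mulLeftRight ℝ (Matrix m m ℂ) (u k x) (u k x)ᴴ)) ∘ₗ P ∘ₗ mmulOp (fun x => (coordMat e (ContinuousLinearMap.mulLeftRight ℝ (Matrix m m ℂ) (u k x) (u k x)ᴴ))ᵀ) = NL - NV k)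
    (hχ1 : ∀ k x, |χX k x| ≤ 1) (hψχ : ∀ k, mulOp (fun p : X × ι => ψX k p.1) ∘ₗ mulOp (fun p : X × ι => χX k p.1) = mulOp (fun p : X × ι => χX k p.1))
    (hCloc : ∀ k x, χX k x ≠ 0 → ∀ i, ∑ j, |tCoefC η (gaugePair τ fun μ x => coordMat e (ContinuousLinearMap.mulLeftRight ℝ (Matrix m m ℂ) (u k x * U μ x * (u k (τ μ x))ᴴ) (u k x * U μ x * (u k (τ μ x))ᴴ)ᴴ)) x i j| ≤ rV)
    (hAloc : ∀ k j' x, χX k x ≠ 0 → ∀ i, ∑ j, |tCoefA η (gaugePair τ fun μ x => coordMat e (ContinuousLinearMap.mulLeftRight ℝ (Matrix m m ℂ) (u k x * U μ x * (u k (τ μ x))ᴴ) (u k x * U μ x * (u k (τ μ x))ᴴ)ᴴ)) j' x i j| ≤ rV)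
    (hNVcut : ∀ k, HasMaj (BlockNorm.ofBlocks g (liftBlk blk ι)) (BlockNorm.ofBlocks g (liftBlk blk ι)) (mulOp (fun p : X × ι => ψX k p.1) ∘ₗ NV k ∘ₗ mulOp (fun p : X × ι => χX k p.1)) (fun y y' => RN * Real.exp (-(δV * g.dist y y'))))
    (hfarN : ∀ k, HasMaj (BlockNorm.ofBlocks g (liftBlk blk ι)) (BlockNorm.ofBlocks g (liftBlk blk ι)) ((LinearMap.id - mulOp (fun p : X × ι => ψX k p.1)) ∘ₗ NV k ∘ₗ mulOp (fun p : X × ι => χX k p.1)) (fun y y' => θF * Real.exp (-(ρF * g.dist y y'))))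
    -- supports of the partition inside `ψ_k` and `χ_k` (with shifts and differences)
    (hhψ : ∀ k, mulOp (fun p : X × ι => hX k p.1) ∘ₗ mulOp (fun p : X × ι => ψX k p.1) = mulOp (fun p : X × ι => hX k p.1)) (hχh : ∀ k, mulOp (fun p : X × ι => χX k p.1) ∘ₗ mulOp (fun p : X × ι => hX k p.1) = mulOp (fun p : X × ι => hX k p.1))
    (hhs' : ∀ k μ, mulOp (fun p : X × ι => χX k p.1) ∘ₗ mulOp ((fun p : X × ι => hX k p.1) ∘ (liftEquiv (τ μ) ι)) = mulOp ((fun p : X × ι => hX k p.1) ∘ (liftEquiv (τ μ) ι)))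
    (hhsb' : ∀ k μ, mulOp (fun p : X × ι => χX k p.1) ∘ₗ mulOp ((fun p : X × ι => hX k p.1) ∘ (liftEquiv (τ μ) ι).symm) = mulOp ((fun p : X × ι => hX k p.1) ∘ (liftEquiv (τ μ) ι).symm))
    (hhdd' : ∀ k μ, mulOp (fun p : X × ι => χX k p.1) ∘ₗ mulOp (fgrad η⁻¹ (liftEquiv (τ μ) ι) (fun p : X × ι => hX k p.1)) = mulOp (fgrad η⁻¹ (liftEquiv (τ μ) ι) (fun p : X × ι => hX k p.1)))
    (hhddb' : ∀ k μ, mulOp (fun p : X × ι => χX k p.1) ∘ₗ mulOp (bgrad η⁻¹ (liftEquiv (τ μ) ι) (fun p : X × ι => hX k p.1)) = mulOp (bgrad η⁻¹ (liftEquiv (τ μ) ι) (fun p : X × ι => hX k p.1)))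
    (hq' : Nov * ((Fintype.card ι : ℝ) ^ 2 * ((((Fintype.card J : ℝ) * (c₂ * ((β + (β₁ + ct * β)) * (1 - (β + (β₁ + ct * β)) * (R * cr) * cr)⁻¹) + 2 * (c₁ * ((β + (β₁ + ct * β)) * (1 - (β + (β₁ + ct * β)) * (R * cr) * cr)⁻¹))) + θW + cN * ((β + (β₁ + ct * β)) * (1 - (β + (β₁ + ct * β)) * (R * cr) * cr)⁻¹) * cr)
          + ((ℓ * (Real.exp 1 * ε)⁻¹ + 2 * (ω + ℓ * d₁)) * R * ((β + (β₁ + ct * β)) * (1 - (β + (β₁ + ct * β)) * (R * cr) * cr)⁻¹) * cr + R * c₁ * ((β + (β₁ + ct * β)) * (1 - (β + (β₁ + ct * β)) * (R * cr) * cr)⁻¹) * cr)) + (θF * (1 * ((β + (β₁ + ct * β)) * (1 - (β + (β₁ + ct * β)) * (R * cr) * cr)⁻¹)) * cr)) + (Fintype.card ι : ℝ) ^ 2 * ((ε₀ * (1 - (β + (β₁ + ct * β)) * (R * cr) * cr)⁻¹) + 0)) * cr < 1)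
    -- THE LEFT FACTOR (n15-c∕269): a jet index, the global operator `D`, its Leibniz rule through the partition, its GAUGE COVARIANCE `D∘M_{W_kᵀ} = M_{v_kᵀ}∘(∇_j + P^sp_k + P^far_k)`
    -- (`W_k = coordMat e Ad_{u_k}`), the species part `P^sp_k` (output-localized on the cube's region, small) and the far part `P^far_k` (annihilated by the cube's cut-off)
    (jj : J ⊕ J) {Dg : (X × ι → ℝ) →ₗ[ℝ] (X × ι → ℝ)} {vg : K → X → Matrix ι ι ℝ} {Psp Pfar : K → (X × ι → ℝ) →ₗ[ℝ] (X × ι → ℝ)} {hsX dhX : K → X → ℝ} {cs cd rP ρP : ℝ}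
    (hcs : 0 ≤ cs) (hcd : 0 ≤ cd) (hrP : 0 ≤ rP) (hρP : ρ₃ + σ ≤ ρP) (hvg' : ∀ k x, (vg k x)ᵀ * vg k x = 1)
    (hDcov : ∀ k, Dg ∘ₗ mmulOp (fun x => (coordMat e (ContinuousLinearMap.mulLeftRight ℝ (Matrix m m ℂ) (u k x) (u k x)ᴴ))ᵀ) = mmulOp (fun x => (vg k x)ᵀ) ∘ₗ (Sum.elim (fun μ => fgrad η⁻¹ (liftEquiv (τ μ) ι)) (fun μ => bgrad η⁻¹ (liftEquiv (τ μ) ι)) jj + Psp k + Pfar k))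
    (hDleib : ∀ k, Dg ∘ₗ mulOp (fun p : X × ι => hX k p.1) = mulOp (fun p : X × ι => hsX k p.1) ∘ₗ Dg + mulOp (fun p : X × ι => dhX k p.1))
    (hhs : ∀ k (p : X × ι), |hsX k p.1| ≤ cs) (hdh : ∀ k (p : X × ι), |dhX k p.1| ≤ cd)
    (hPsp : ∀ k, HasMaj (BlockNorm.ofBlocks g (liftBlk blk ι)) (BlockNorm.ofBlocks g (liftBlk blk ι)) (Psp k) (fun y y' => ind (Sk k) y * (rP * Real.exp (-(ρP * g.dist y y')))))
    (hPfar : ∀ k, Pfar k ∘ₗ mulOp (fun p : X × ι => χX k p.1) = 0) :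
    HasMaj (BlockNorm.ofBlocks g (liftBlk blk ι)) (BlockNorm.ofBlocks g (liftBlk blk ι))
      (Dg ∘ₗ glueInv (parametrix (fun k (p : X × ι) => hX k p.1) (fun k => mmulOp (fun x => (coordMat e (ContinuousLinearMap.mulLeftRight ℝ (Matrix m m ℂ) (u k x) (u k x)ᴴ))ᵀ) ∘ₗ (projO none ∘ₗ bgPropV (stack (mulOp (fun p : X × ι => χtX k p.1) ∘ₗ N k) (fun j => Sum.elim (fun μ => fgrad η⁻¹ (liftEquiv (τ μ) ι)) (fun μ => bgrad η⁻¹ (liftEquiv (τ μ) ι)) j ∘ₗ (mulOp (fun p : X × ι => χtX k p.1) ∘ₗ N k))) (mulOp (fun p : X × ι => ψX k p.1) ∘ₗ (unstackM (tCoefC η (gaugePair τ fun μ x => coordMat e (ContinuousLinearMap.mulLeftRight ℝ (Matrix m m ℂ) (u k x * U μ x * (u k (τ μ x))ᴴ) (u k x * U μ x * (u k (τ μ x))ᴴ)ᴴ)))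
            (tCoefA η (gaugePair τ fun μ x => coordMat e (ContinuousLinearMap.mulLeftRight ℝ (Matrix m m ℂ) (u k x * U μ x * (u k (τ μ x))ᴴ) (u k x * U μ x * (u k (τ μ x))ᴴ)ᴴ))) + NV k ∘ₗ projO none) ∘ₗ mulOp (fun q : (X × ι) × Option (J ⊕ J) => χX k q.1.1))) ∘ₗ mmulOp (fun x => coordMat e (ContinuousLinearMap.mulLeftRight ℝ (Matrix m m ℂ) (u k x) (u k x)ᴴ))))
        (remainder (covLapM τ η (gaugePair τ (fun μ x => coordMat e (ContinuousLinearMap.mulLeftRight ℝ (Matrix m m ℂ) (U μ x) (U μ x)ᴴ))) + P) (fun k (p : X × ι) => hX k p.1) (fun k => mmulOp (fun x => (coordMat e (ContinuousLinearMap.mulLeftRight ℝ (Matrix m m ℂ) (u k x) (u k x)ᴴ))ᵀ) ∘ₗ (projO none ∘ₗ bgPropV (stack (mulOp (fun p : X × ι => χtX k p.1) ∘ₗ N k) (fun j => Sum.elim (fun μ => fgrad η⁻¹ (liftEquiv (τ μ) ι)) (fun μ => bgrad η⁻¹ (liftEquiv (τ μ) ι)) j ∘ₗ (mulOp (fun p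 : X × ι => χtX k p.1) ∘ₗ N k))) (mulOp (fun p : X × ι => ψX k p.1) ∘ₗ (unstackM (tCoefC η (gaugePair τ fun μ x => coordMat e (ContinuousLinearMap.mulLeftRight ℝ (Matrix m m ℂ) (u k x * U μ x * (u k (τ μ x))ᴴ) (u k x * U μ x * (u k (τ μ x))ᴴ)ᴴ)))
            (tCoefA η (gaugePair τ fun μ x => coordMat e (ContinuousLinearMap.mulLeftRight ℝ (Matrix m m ℂ) (u k x * U μ x * (u k (τ μ x))ᴴ) (u k x * U μ x * (u k (τ μ x))ᴴ)ᴴ))) + NV k ∘ₗ projO none) ∘ₗ mulOp (fun q : (X × ι) × Option (J ⊕ J) => χX k q.1.1))) ∘ₗ mmulOp (fun x => coordMat e (ContinuousLinearMap.mulLeftRight ℝ (Matrix m m ℂ) (u k x) (u k x)ᴴ))) -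
          ∑ k, (mmulOp (fun x => (coordMat e (ContinuousLinearMap.mulLeftRight ℝ (Matrix m m ℂ) (u k x) (u k x)ᴴ))ᵀ) ∘ₗ ((((-(mulOp (fun p : X × ι => hX k p.1) ∘ₗ NL ∘ₗ mulOp (1 - fun p : X × ι => χtX k p.1))) ∘ₗ N k) ∘ₗ (LinearMap.id + ((mulOp (fun p : X × ι => ψX k p.1) ∘ₗ (unstackM (tCoefC η (gaugePair τ fun μ x => coordMat e (ContinuousLinearMap.mulLeftRight ℝ (Matrix m m ℂ) (u k x * U μ x * (u k (τ μ x))ᴴ) (u k x * U μ x * (u k (τ μ x))ᴴ)ᴴ)))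
            (tCoefA η (gaugePair τ fun μ x => coordMat e (ContinuousLinearMap.mulLeftRight ℝ (Matrix m m ℂ) (u k x * U μ x * (u k (τ μ x))ᴴ) (u k x * U μ x * (u k (τ μ x))ᴴ)ᴴ))) + NV k ∘ₗ projO none) ∘ₗ mulOp (fun q : (X × ι) × Option (J ⊕ J) => χX k q.1.1)) ∘ₗ stack LinearMap.id (fun j => Sum.elim (fun μ => fgrad η⁻¹ (liftEquiv (τ μ) ι)) (fun μ => bgrad η⁻¹ (liftEquiv (τ μ) ι)) j)) ∘ₗ (projO none ∘ₗ bgPropV (stack (mulOp (fun p : X × ι => χtX k p.1) ∘ₗ N k) (fun j => Sum.elim (fun μ => fgrad η⁻¹ (liftEquiv (τ μ) ι)) (fun μ => bgrad η⁻¹ (liftEquiv (τ μ) ι)) j ∘ₗ (mulOp (fun p : X × ι => χtX k p.1) ∘ₗ N k))) (mulOp (fun p : X × ι => ψX k p.1) ∘ₗ (unstackM (tCoefC η (gaugePair τ fun μ x => coordMat e (ContinuousLinearMap.mulLeftRight ℝ (Matrix m m ℂ) (u k x * U μ x * (u k (τ μ x))ᴴ) (u k x * U μ x * (u k (τ μ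 x))ᴴ)ᴴ)))
            (tCoefA η (gaugePair τ fun μ x => coordMat e (ContinuousLinearMap.mulLeftRight ℝ (Matrix m m ℂ) (u k x * U μ x * (u k (τ μ x))ᴴ) (u k x * U μ x * (u k (τ μ x))ᴴ)ᴴ))) + NV k ∘ₗ projO none) ∘ₗ mulOp (fun q : (X × ι) × Option (J ⊕ J) => χX k q.1.1)))) + mulOp (fun p : X × ι => hX k p.1) ∘ₗ (-(((unstackM (tCoefC η (gaugePair τ fun μ x => coordMat e (ContinuousLinearMap.mulLeftRight ℝ (Matrix m m ℂ) (u k x * U μ x * (u k (τ μ x))ᴴ) (u k x * U μ x * (u k (τ μ x))ᴴ)ᴴ)))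
            (tCoefA η (gaugePair τ fun μ x => coordMat e (ContinuousLinearMap.mulLeftRight ℝ (Matrix m m ℂ) (u k x * U μ x * (u k (τ μ x))ᴴ) (u k x * U μ x * (u k (τ μ x))ᴴ)ᴴ))) + NV k ∘ₗ projO none) - mulOp (fun p : X × ι => ψX k p.1) ∘ₗ (unstackM (tCoefC η (gaugePair τ fun μ x => coordMat e (ContinuousLinearMap.mulLeftRight ℝ (Matrix m m ℂ) (u k x * U μ x * (u k (τ μ x))ᴴ) (u k x * U μ x * (u k (τ μ x))ᴴ)ᴴ)))
            (tCoefA η (gaugePair τ fun μ x => coordMat e (ContinuousLinearMap.mulLeftRight ℝ (Matrix m m ℂ) (u k x * U μ x * (u k (τ μ x))ᴴ) (u k x * U μ x * (u k (τ μ x))ᴴ)ᴴ))) + NV k ∘ₗ projO none) ∘ₗ mulOp (fun q : (X × ι) × Option (J ⊕ J) => χX k q.1.1)) ∘ₗ stack LinearMap.id (fun j => Sum.elim (fun μ => fgrad η⁻¹ (liftEquiv (τ μ) ι)) (fun μ => bgrad η⁻¹ (liftEquiv (τ μ) ι)) j))) ∘ₗ (projO none ∘ₗ bgPropV (stack (mulOp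 (fun p : X × ι => χtX k p.1) ∘ₗ N k) (fun j => Sum.elim (fun μ => fgrad η⁻¹ (liftEquiv (τ μ) ι)) (fun μ => bgrad η⁻¹ (liftEquiv (τ μ) ι)) j ∘ₗ (mulOp (fun p : X × ι => χtX k p.1) ∘ₗ N k))) (mulOp (fun p : X × ι => ψX k p.1) ∘ₗ (unstackM (tCoefC η (gaugePair τ fun μ x => coordMat e (ContinuousLinearMap.mulLeftRight ℝ (Matrix m m ℂ) (u k x * U μ x * (u k (τ μ x))ᴴ) (u k x * U μ x * (u k (τ μ x))ᴴ)ᴴ)))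
            (tCoefA η (gaugePair τ fun μ x => coordMat e (ContinuousLinearMap.mulLeftRight ℝ (Matrix m m ℂ) (u k x * U μ x * (u k (τ μ x))ᴴ) (u k x * U μ x * (u k (τ μ x))ᴴ)ᴴ))) + NV k ∘ₗ projO none) ∘ₗ mulOp (fun q : (X × ι) × Option (J ⊕ J) => χX k q.1.1))))) ∘ₗ mmulOp (fun x => coordMat e (ContinuousLinearMap.mulLeftRight ℝ (Matrix m m ℂ) (u k x) (u k x)ᴴ))) ∘ₗ mulOp (fun p : X × ι => hX k p.1)))
      (fun y y' => Nov * (cs * ((Fintype.card ι : ℝ) ^ 2 * (((β + (β₁ + ct * β)) * (1 - (β + (β₁ + ct * β)) * (R * cr) * cr)⁻¹) + rP * ((β + (β₁ + ct * β)) * (1 - (β + (β₁ + ct * β)) * (R * cr) * cr)⁻¹) * cr)) + cd * ((Fintype.card ι : ℝ) ^ 2 * ((β + (β₁ + ct * β)) * (1 - (β + (β₁ + ct * β)) * (R * cr) * cr)⁻¹))) * (1 - Nov * ((Fintype.card ι : ℝ) ^ 2 * ((((Fintype.card J : ℝ) * (c₂ * ((β + (β₁ + ct * β)) * (1 - (β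 + (β₁ + ct * β)) * (R * cr) * cr)⁻¹) + 2 * (c₁ * ((β + (β₁ + ct * β)) * (1 - (β + (β₁ + ct * β)) * (R * cr) * cr)⁻¹))) + θW + cN * ((β + (β₁ + ct * β)) * (1 - (β + (β₁ + ct * β)) * (R * cr) * cr)⁻¹) * cr)
          + ((ℓ * (Real.exp 1 * ε)⁻¹ + 2 * (ω + ℓ * d₁)) * R * ((β + (β₁ + ct * β)) * (1 - (β + (β₁ + ct * β)) * (R * cr) * cr)⁻¹) * cr + R * c₁ * ((β + (β₁ + ct * β)) * (1 - (β + (β₁ + ct * β)) * (R * cr) * cr)⁻¹) * cr)) + (θF * (1 * ((β + (β₁ + ct * β)) * (1 - (β + (β₁ + ct * β)) * (R * cr) * cr)⁻¹)) * cr)) + (Fintype.card ι : ℝ) ^ 2 * ((ε₀ * (1 - (β + (β₁ + ct * β)) * (R * cr) * cr)⁻¹) + 0)) * cr)⁻¹ * cr * Real.exp (-((ρ₃ - σ) * g.dist y y'))) := by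
  have hβb : 0 ≤ β + (β₁ + ct * β) := by positivity
  have hqi : 0 ≤ (1 - (β + (β₁ + ct * β)) * (R * cr) * cr)⁻¹ := inv_nonneg.2 (by linarith)
  have hB : 0 ≤ ((β + (β₁ + ct * β)) * (1 - (β + (β₁ + ct * β)) * (R * cr) * cr)⁻¹) := mul_nonneg hβb hqi
  have hug : ∀ k x, coordMat e (ContinuousLinearMap.mulLeftRight ℝ (Matrix m m ℂ) (u k x) (u k x)ᴴ) * (coordMat e (ContinuousLinearMap.mulLeftRight ℝ (Matrix m m ℂ) (u k x) (u k x)ᴴ))ᵀ = 1 := fun k x => (uN_siteGauge_orthogonal e (u k) he (hu k) x).1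
  have hug' : ∀ k x, (coordMat e (ContinuousLinearMap.mulLeftRight ℝ (Matrix m m ℂ) (u k x) (u k x)ᴴ))ᵀ * coordMat e (ContinuousLinearMap.mulLeftRight ℝ (Matrix m m ℂ) (u k x) (u k x)ᴴ) = 1 := fun k x => (uN_siteGauge_orthogonal e (u k) he (hu k) x).2
  have hcov : ∀ k, mmulOp (fun x => coordMat e (ContinuousLinearMap.mulLeftRight ℝ (Matrix m m ℂ) (u k x) (u k x)ᴴ)) ∘ₗ (covLapM τ η (gaugePair τ (fun μ x => coordMat e (ContinuousLinearMap.mulLeftRight ℝ (Matrix m m ℂ) (U μ x) (U μ x)ᴴ))) + P) ∘ₗ mmulOp (fun x => (coordMat e (ContinuousLinearMap.mulLeftRight ℝ (Matrix m m ℂ) (u k x) (u k x)ᴴ))ᵀ) =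
      (lapOp η⁻¹ (fun μ => liftEquiv (τ μ) ι) 0 + NL - (mulOp (fun p : X × ι => ψX k p.1) ∘ₗ (unstackM (tCoefC η (gaugePair τ fun μ x => coordMat e (ContinuousLinearMap.mulLeftRight ℝ (Matrix m m ℂ) (u k x * U μ x * (u k (τ μ x))ᴴ) (u k x * U μ x * (u k (τ μ x))ᴴ)ᴴ)))
            (tCoefA η (gaugePair τ fun μ x => coordMat e (ContinuousLinearMap.mulLeftRight ℝ (Matrix m m ℂ) (u k x * U μ x * (u k (τ μ x))ᴴ) (u k x * U μ x * (u k (τ μ x))ᴴ)ᴴ))) + NV k ∘ₗ projO none) ∘ₗ mulOp (fun q : (X × ι) × Option (J ⊕ J) => χX k q.1.1)) ∘ₗ stack LinearMap.id (fun j => Sum.elim (fun μ => fgrad η⁻¹ (liftEquiv (τ μ) ι)) (fun μ => bgrad η⁻¹ (liftEquiv (τ μ) ι)) j)) + (-(((unstackM (tCoefC η (gaugePair τ fun μ x => coordMat e (ContinuousLinearMap.mulLeftRight ℝ (Matrix m m ℂ) (u k x * U μ x * (u k (τ μ x))ᴴ) (u k x * U μ x * (u k (τ μ x))ᴴ)ᴴ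)))
            (tCoefA η (gaugePair τ fun μ x => coordMat e (ContinuousLinearMap.mulLeftRight ℝ (Matrix m m ℂ) (u k x * U μ x * (u k (τ μ x))ᴴ) (u k x * U μ x * (u k (τ μ x))ᴴ)ᴴ))) + NV k ∘ₗ projO none) - mulOp (fun p : X × ι => ψX k p.1) ∘ₗ (unstackM (tCoefC η (gaugePair τ fun μ x => coordMat e (ContinuousLinearMap.mulLeftRight ℝ (Matrix m m ℂ) (u k x * U μ x * (u k (τ μ x))ᴴ) (u k x * U μ x * (u k (τ μ x))ᴴ)ᴴ)))
            (tCoefA η (gaugePair τ fun μ x => coordMat e (ContinuousLinearMap.mulLeftRight ℝ (Matrix m m ℂ) (u k x * U μ x * (u k (τ μ x))ᴴ) (u k x * U μ x * (u k (τ μ x))ᴴ)ᴴ))) + NV k ∘ₗ projO none) ∘ₗ mulOp (fun q : (X × ι) × Option (J ⊕ J) => χX k q.1.1)) ∘ₗ stack LinearMap.id (fun j => Sum.elim (fun μ => fgrad η⁻¹ (liftEquiv (τ μ) ι)) (fun μ => bgrad η⁻¹ (liftEquiv (τ μ) ι)) j))) := fun k => by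
    rw [uN_localOp_species_form e τ (u k) U η he (hu k) P, hP k, ← localOp_eq_cut_add_farDefect, LinearMap.add_comp, LinearMap.comp_assoc, projO_none_comp_stack, LinearMap.comp_id]
    abel
  have hV : ∀ k, HasMaj (BlockNorm.ofBlocks g (blkPair (liftBlk blk ι))) (BlockNorm.ofBlocks g (liftBlk blk ι)) (mulOp (fun p : X × ι => ψX k p.1) ∘ₗ (unstackM (tCoefC η (gaugePair τ fun μ x => coordMat e (ContinuousLinearMap.mulLeftRight ℝ (Matrix m m ℂ) (u k x * U μ x * (u k (τ μ x))ᴴ) (u k x * U μ x * (u k (τ μ x))ᴴ)ᴴ)))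
            (tCoefA η (gaugePair τ fun μ x => coordMat e (ContinuousLinearMap.mulLeftRight ℝ (Matrix m m ℂ) (u k x * U μ x * (u k (τ μ x))ᴴ) (u k x * U μ x * (u k (τ μ x))ᴴ)ᴴ))) + NV k ∘ₗ projO none) ∘ₗ mulOp (fun q : (X × ι) × Option (J ⊕ J) => χX k q.1.1)) (fun y y' => R * Real.exp (-(δV * g.dist y y'))) := fun k =>
    (hasMaj_cutPert_structural_of_local blk hd0 hrV hRN (hχ1 k) (hCloc k) (fun μ x hx => hAloc k μ x hx) (hψχ k) (hNVcut k)).mono fun y y' =>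
      mul_le_mul_of_nonneg_right hRle (Real.exp_nonneg _)
  have hW : ∀ k, HasMaj (BlockNorm.ofBlocks g (liftBlk blk ι)) (BlockNorm.ofBlocks g (liftBlk blk ι)) (commOp (0 : (X × ι → ℝ) →ₗ[ℝ] (X × ι → ℝ)) (fun p : X × ι => hX k p.1) ∘ₗ (projO none ∘ₗ bgPropV (stack (mulOp (fun p : X × ι => χtX k p.1) ∘ₗ N k)
          (fun j => Sum.elim (fun μ => fgrad η⁻¹ (liftEquiv (τ μ) ι)) (fun μ => bgrad η⁻¹ (liftEquiv (τ μ) ι)) j ∘ₗ (mulOp (fun p : X × ι => χtX k p.1) ∘ₗ N k))) (mulOp (fun p : X × ι => ψX k p.1) ∘ₗ (unstackM (tCoefC η (gaugePair τ fun μ x => coordMat e (ContinuousLinearMap.mulLeftRight ℝ (Matrix m m ℂ) (u k x * U μ x * (u k (τ μ x))ᴴ) (u k x * U μ x * (u k (τ μ x))ᴴ)ᴴ)))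
            (tCoefA η (gaugePair τ fun μ x => coordMat e (ContinuousLinearMap.mulLeftRight ℝ (Matrix m m ℂ) (u k x * U μ x * (u k (τ μ x))ᴴ) (u k x * U μ x * (u k (τ μ x))ᴴ)ᴴ))) + NV k ∘ₗ projO none) ∘ₗ mulOp (fun q : (X × ι) × Option (J ⊕ J) => χX k q.1.1))))
      (fun y y' => ind (Sk k) y * ind (Sk k) y' * (θW * Real.exp (-(ρ₂ * g.dist y y')))) := fun k => by
    rw [show commOp (0 : (X × ι → ℝ) →ₗ[ℝ] (X × ι → ℝ)) (fun p : X × ι => hX k p.1) = 0 from by simp [commOp], LinearMap.zero_comp]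
    exact (hasMaj_zero _ _).mono fun y y' => mul_nonneg (mul_nonneg (ind_nonneg _ _) (ind_nonneg _ _)) (mul_nonneg hθW (Real.exp_nonneg _))
  have hFX := fun k => hasMaj_mulOp_farDefect_smoothCutDressed blk τ η⁻¹ (Vf := (unstackM (tCoefC η (gaugePair τ fun μ x => coordMat e (ContinuousLinearMap.mulLeftRight ℝ (Matrix m m ℂ) (u k x * U μ x * (u k (τ μ x))ᴴ) (u k x * U μ x * (u k (τ μ x))ᴴ)ᴴ)))
            (tCoefA η (gaugePair τ fun μ x => coordMat e (ContinuousLinearMap.mulLeftRight ℝ (Matrix m m ℂ) (u k x * U μ x * (u k (τ μ x))ᴴ) (u k x * U μ x * (u k (τ μ x))ᴴ)ᴴ))) + NV k ∘ₗ projO none)) htri hd hrow hσ hβ hβ₁ hct hR hcr hσρ hρ₁V hρ₁G hρ₂ hρ₂₁ (hχt k) (hdχt k) (hdχtb k) (hsub k) (hχ k) (hs k)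
    (hsb k) (hdd k) (hddb k) (hs' k) (hsb' k) (hdd' k) (hddb' k) (hcut k) (hcutF k) (hcutB k) (hV k) hq (hhψ k) ρ₃
  have hFK := fun k => hasMaj_commOp_farDefect_structural blk τ η⁻¹ (NV := NV k)
    (Cc := tCoefC η (gaugePair τ fun μ x => coordMat e (ContinuousLinearMap.mulLeftRight ℝ (Matrix m m ℂ) (u k x * U μ x * (u k (τ μ x))ᴴ) (u k x * U μ x * (u k (τ μ x))ᴴ)ᴴ)))
    (Ac := tCoefA η (gaugePair τ fun μ x => coordMat e (ContinuousLinearMap.mulLeftRight ℝ (Matrix m m ℂ) (u k x * U μ x * (u k (τ μ x))ᴴ) (u k x * U μ x * (u k (τ μ x))ᴴ)ᴴ))) htri hd hrow hσ hβ hβ₁ hct hR hcr hσρ hρ₁V hρ₁G hρ₂ hρ₂₁ (hSχ k) (hSψ k) (hχt k) (hdχt k) (hdχtb k) (hsub k) (hχ k) (hs k)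
    (hsb k) (hdd k) (hddb k) (hs' k) (hsb' k) (hdd' k) (hddb' k) (hNψ k) (hcut k) (hcutF k) (hcutB k) (hV k) hq hθF hρ₃ hρ₃₂ hρF (hhabs k) (hhψ k) (hχh k) (hhs' k) (hhsb' k) (hhdd' k)
    (hhddb' k) (hψχ k) (hfarN k)
  have hθF' : 0 ≤ θF * (1 * ((β + (β₁ + ct * β)) * (1 - (β + (β₁ + ct * β)) * (R * cr) * cr)⁻¹)) * cr := by positivity
  exact hasMaj_comp_glueInv_smoothCutDressed_localGauges blk τ η⁻¹ htri hd hd0 hsymm hrow hσ hβ hβ₁ hct hR hε₀ hcr hNov hσρ hρ₁V hρ₁G hρ₂ hρ₂₁ hρ₂T hρ₃ hρ₃₂ hρ₃V hρ₃N hσρ₃ hε hc₁ hc₂ hθW hcN hℓ hω hd₁ hSχ hSψ hχt hdχt hdχtb hsub hχ hs hsb hdd hddb hs' hsb' hdd' hddb' hNψ hcut hcutF hcutB hhabs hhcut hh1 hh1b hh2 hLip hrh hstep hN hT hV hq hW hKN hug hug' hθF' (le_refl (0:ℝ)) hcov hFK hFX hq'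
    jj hcs hcd hrP hρP hvg' hDcov hDleib hhs hdh hPsp hPfar


end Summit.QuantumFields.YangMills.BalabanUVNodes.N15.CurvedSpecies
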